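import Literature.Algebra.Homology.OrderedCechSystemFull
import Literature.Algebra.Homology.OrderedCechSystemAlternatingDifferential
import HarnessLib

/-!
# The full Čech complex of a system vs. the ordered one: `res`, `ext` are cochain maps, `res ∘ ext = 𝟙`;
# the Leibniz rule for the position cup product; `res` and the pull-backs are multiplicative
# (The Stacks Project, Tags 01FG, 01FP; Serre FAC n° 20; Godement II §6.6)

Layer `Algebra/Homology`, PROOF lane (theorems only).  Sequel to `OrderedCechSystemFull` (DEFs `Full.complex`, `Full.cup`,
`Full.pullback`, `Full.res`, `Full.ext`) and `OrderedCechSystemAlternatingDifferential` (the full differential formula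
`SysCochain.altEvalAt_sysD`).  Cell `hodgecm-mathlib` FLOOR 0, P1 sub-line F-11, packet (iv)∕J3, brick **F-F** (RULINGS #3 (R14);
F0P1b-p01 (g0)).  Everything proved; no definition, no instance, no notation, no named fact.

* §1 **`Full.d_ext`** (`ext` is a cochain map `Č_ord → F`), **`Full.sysD_res`** (`res` is a cochain map `F → Č_ord`),
  **`Full.res_ext`** (`res ∘ ext = 𝟙` on the nose) — [StacksProject, Tag 01FG]: «the alternating Čech complex is a subcomplex of the
  Čech complex … the ordered complex is a quotient∕direct summand».
* §2 **`Full.d_cup`** — the Leibniz rule `d(x ∪ y) = dx ∪ y + (-1)^p x ∪ dy` for the position cup product along a NATURAL pairing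
  ([StacksProject, Tag 01FP]; [Godement1958, II §6.6]); `Full.pullback_cup` (pull-backs along ANY index map are multiplicative
  ON COCHAINS).
-/

universe v u

open CategoryTheory

set_option backward.isDefEq.respectTransparency false -- `ModuleCat`-valued functors (as in ★ `OrderedCechSystem`)

noncomputable section

namespace Literature.Algebra.Homology

namespace OrderedCech

namespace Full

variable {ι : Type} [LinearOrder ι] {A : Type u} [CommRing A] (M : Finset ι ⥤ ModuleCat.{v} A)

/-! ## §0 Plumbing -/

/-- The cosimplicial sign `(-1)^k ∈ ℤ` acts as the ring sign `(-1)^k ∈ A` (sign bookkeeping of the Čech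
differential). [cite: StacksProject, Tag 01FG] -/
theorem neg_one_pow_zsmul {V : Type*} [AddCommGroup V] [Module A V] (k : ℕ) (x : V) :
    ((-1 : ℤ) ^ k) • x = ((-1 : A) ^ k) • x := by
  rw [← Int.cast_smul_eq_zsmul A, Int.cast_pow, Int.cast_neg, Int.cast_one]

variable {M} in
/-- Components of a full cochain at equal tuples agree after restriction (transport along an equality of tuples).
[cite: StacksProject, Tag 01FG] -/
theorem map_apply_congr {n : ℕ} (c : Cochain M n) {α α' : Fin (n + 1) → ι} (h : α = α') {t : Finset ι}
    (hα : Finset.univ.image α ⊆ t) (hα' : Finset.univ.image α' ⊆ t) :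
    (M.map (homOfLE hα)).hom (c α) = (M.map (homOfLE hα')).hom (c α') := by
  subst h; rfl

variable {M} in
omit [LinearOrder ι] in
/-- Composition of two restrictions of a component. [cite: StacksProject, Tag 01FG] -/
theorem map_map_apply {s t t' : Finset ι} (h : s ⊆ t) (h' : t ⊆ t') (x : M.obj s) :
    (M.map (homOfLE h')).hom ((M.map (homOfLE h)).hom x) = (M.map (homOfLE (h.trans h'))).hom x := by
  rw [← ModuleCat.comp_apply, ← M.map_comp]; rfl

/-! ## §1 `ext` and `res` are cochain maps; `res ∘ ext = 𝟙` -/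

/-- **The alternating extension `ext : Č_ord → F` is a cochain map** — the full differential formula
`SysCochain.altEvalAt_sysD` read at `t = {β}`. [cite: StacksProject, Tag 01FG] -/
theorem d_ext (n : ℕ) (g : SysCochain M n) :
    ((complex M).d n (n + 1)).hom (ext M n g) = ext M (n + 1) (sysD M n g) := by
  funext β
  rw [complex_d_apply, ext_apply, SysCochain.altEvalAt_sysD M g β _ subset_rfl]
  refine Finset.sum_congr rfl fun j _ => ?_
  rw [neg_one_pow_zsmul (A := A), ext_apply, SysCochain.map_altEvalAt g _ _ _ subset_rfl]

/-- **The restriction `res : F → Č_ord` is a cochain map** — faces of increasing tuples are increasing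
(`orderEmbOfFin_erase`) and the two sign conventions agree (`sign_orderEmbOfFin`). [cite: StacksProject, Tag 01FG]
[cite: GortzWedhorn2023, Def. 21.68 (p. 180)] -/
theorem sysD_res (n : ℕ) (c : Cochain M n) :
    sysD M n (res M n c) = res M (n + 1) (((complex M).d n (n + 1)).hom c) := by
  classical
  funext σ
  have hc : σ.1.card = n + 2 := card_simplex (n + 1) σ
  rw [res_apply, complex_d_apply, map_sum, sysD_apply, sum_eq_sum_orderEmbOfFin σ.1 hc]
  refine Finset.sum_congr rfl fun j _ => ?_
  rw [map_zsmul, neg_one_pow_zsmul (A := A), sign_orderEmbOfFin, map_map_apply]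
  congr 1
  -- the face `σ ∖ e_j`
  have hcard' : (σ.1.erase (σ.1.orderEmbOfFin hc j)).card = n + 1 := by
    have := Finset.card_erase_of_mem (Finset.orderEmbOfFin_mem σ.1 hc j); omega
  have hσ : (σ.1.erase (σ.1.orderEmbOfFin hc j)).Nonempty ∧
      ((σ.1.erase (σ.1.orderEmbOfFin hc j)).card : ℤ) = (n : ℤ) + 1 :=
    ⟨Finset.card_pos.mp (by omega), by exact_mod_cast hcard'⟩
  rw [SysCochain.ext0At_val (res M n c) ⟨σ.1.erase (σ.1.orderEmbOfFin hc j), hσ⟩ σ.1 (Finset.erase_subset _ _),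
    res_apply, map_map_apply]
  exact map_apply_congr c (orderEmbOfFin_erase σ.1 hc j (card_simplex n ⟨_, hσ⟩)) _ _

/-- **`res ∘ ext = 𝟙` on the nose**: an increasing tuple has no inversions. [cite: StacksProject, Tag 01FG] -/
theorem res_ext (n : ℕ) (g : SysCochain M n) : res M n (ext M n g) = g := by
  funext σ
  rw [res_apply, ext_apply, SysCochain.map_altEvalAt g _ _ _ subset_rfl,
    SysCochain.altEvalAt_of_strictMono g (σ.1.orderEmbOfFin (card_simplex n σ)).strictMono,
    image_orderEmbOfFin_simplex, SysCochain.ext0At_self]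

/-- `res` is surjective (split by `ext`). [cite: StacksProject, Tag 01FG] -/
theorem res_surjective (n : ℕ) : Function.Surjective (res M n) :=
  fun g => ⟨ext M n g, res_ext M n g⟩

/-! ## §2 The Leibniz rule for the position cup product -/

section Leibniz

variable {M} {N P : Finset ι ⥤ ModuleCat.{v} A} (μ : ∀ s : Finset ι, M.obj s →ₗ[A] N.obj s →ₗ[A] P.obj s)

omit [LinearOrder ι] in
/-- The value of `Fin.succAbove` («skip position `j`»). [folklore] -/
private theorem val_succAbove {m : ℕ} (j : Fin (m + 1)) (i : Fin m) :
    ((j.succAbove i : Fin (m + 1)) : ℕ) = if (i : ℕ) < j then (i : ℕ) else i + 1 := by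
  unfold Fin.succAbove
  by_cases hi : (i : ℕ) < j
  · rw [if_pos (Fin.lt_def.mpr (by simpa using hi)), if_pos hi, Fin.val_castSucc]
  · rw [if_neg (fun h' => hi (by simpa [Fin.lt_def] using h')), if_neg hi, Fin.val_succ]

omit [LinearOrder ι] in
/-- Faces through the FRONT block: deleting position `j ≤ p` of an `(n+1)`-tuple deletes position `j` of its front
`(p+1)`-face and leaves its back `q`-face untouched. [cite: StacksProject, Tag 01FP] -/
theorem front_back_comp_succAbove_of_le {p q n : ℕ} (h : p + q = n) (h' : p + 1 + q = n + 1) (γ : Fin (n + 2) → ι)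
    (j : Fin (n + 2)) (hj : (j : ℕ) ≤ p) :
    front p q n h (γ ∘ j.succAbove) = front (p + 1) q (n + 1) h' γ ∘ Fin.succAbove ⟨j, by omega⟩ ∧
      back p q n h (γ ∘ j.succAbove) = back (p + 1) q (n + 1) h' γ := by
  constructor
  · funext k
    simp only [Function.comp_apply, front_apply]
    congr 1
    apply Fin.ext
    simp only [val_succAbove]
  · funext k
    simp only [Function.comp_apply, back_apply]
    congr 1
    apply Fin.ext
    simp only [val_succAbove]
    all_goals (split_ifs <;> omega)

omit [LinearOrder ι] in
/-- Faces through the BACK block: deleting position `j = p + 1 + b` of an `(n+1)`-tuple leaves its front `p`-face untouched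
and deletes position `b + 1` of its back `(q+1)`-face. [cite: StacksProject, Tag 01FP] -/
theorem front_back_comp_succAbove_of_gt {p q n : ℕ} (h : p + q = n) (h' : p + (q + 1) = n + 1) (γ : Fin (n + 2) → ι)
    (j : Fin (n + 2)) (b : Fin (q + 1)) (hj : (j : ℕ) = p + 1 + b) :
    front p q n h (γ ∘ j.succAbove) = front p (q + 1) (n + 1) h' γ ∧
      back p q n h (γ ∘ j.succAbove) = back p (q + 1) (n + 1) h' γ ∘ Fin.succAbove b.succ := by
  constructor
  · funext k
    simp only [Function.comp_apply, front_apply]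
    congr 1
    apply Fin.ext
    simp only [val_succAbove]
    all_goals (split_ifs <;> omega)
  · funext k
    simp only [Function.comp_apply, back_apply]
    congr 1
    apply Fin.ext
    simp only [val_succAbove, Fin.val_succ]
    all_goals (split_ifs <;> omega)

omit [LinearOrder ι] in
/-- The two MIDDLE faces coincide: the front `(p+1)`-face minus its last position = the front `p`-face, and the back
`(q+1)`-face minus its first position = the back `q`-face. [cite: StacksProject, Tag 01FP] -/
theorem front_last_back_zero {p q n : ℕ} (h₁ : p + 1 + q = n + 1) (h₂ : p + (q + 1) = n + 1) (γ : Fin (n + 2) → ι) :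
    front (p + 1) q (n + 1) h₁ γ ∘ Fin.succAbove (Fin.last (p + 1)) = front p (q + 1) (n + 1) h₂ γ ∧
      back p (q + 1) (n + 1) h₂ γ ∘ Fin.succAbove 0 = back (p + 1) q (n + 1) h₁ γ := by
  constructor
  · funext k
    simp only [Function.comp_apply, front_apply]
    congr 1
    apply Fin.ext
    simp only [val_succAbove, Fin.val_last]
    all_goals (split_ifs <;> omega)
  · funext k
    simp only [Function.comp_apply, back_apply]
    congr 1
    apply Fin.ext
    simp only [val_succAbove, Fin.val_zero]
    all_goals (split_ifs <;> omega)

/-- A cup term only depends on its two faces (transport along equal tuples). [cite: StacksProject, Tag 01FP] -/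
theorem term_congr {p q : ℕ} (x : Cochain M p) (y : Cochain N q) {t : Finset ι}
    {F F' : Fin (p + 1) → ι} {B B' : Fin (q + 1) → ι} (hF : F = F') (hB : B = B')
    (h₁ : Finset.univ.image F ⊆ t) (h₁' : Finset.univ.image F' ⊆ t)
    (h₂ : Finset.univ.image B ⊆ t) (h₂' : Finset.univ.image B' ⊆ t) :
    μ t ((M.map (homOfLE h₁)).hom (x F)) ((N.map (homOfLE h₂)).hom (y B)) =
      μ t ((M.map (homOfLE h₁')).hom (x F')) ((N.map (homOfLE h₂')).hom (y B')) := by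
  subst hF; subst hB; rfl

/-- **Leibniz rule for the position cup product** along a NATURAL pairing `μ` (`μ_t(a|_t, b|_t) = μ_s(a,b)|_t`):
`d(x ∪ y) = dx ∪ y + (-1)^p · x ∪ dy` on full cochains (`p + q = n`).  The classical Alexander–Whitney computation: the
faces through the front block give `dx ∪ y` except its last term, the faces through the back block give `(-1)^p x ∪ dy`
except its first term, and these two middle terms cancel. [cite: StacksProject, Tag 01FP] [cite: GortzWedhorn2023, (21.29)] -/
theorem d_cup (hμ : ∀ ⦃s t : Finset ι⦄ (hst : s ⊆ t) (a : M.obj s) (b : N.obj s),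
      (P.map (homOfLE hst)).hom (μ s a b) = μ t ((M.map (homOfLE hst)).hom a) ((N.map (homOfLE hst)).hom b))
    (p q n : ℕ) (h : p + q = n) (x : Cochain M p) (y : Cochain N q) :
    ((complex P).d n (n + 1)).hom (cup μ p q n h x y) =
      cup μ (p + 1) q (n + 1) (by omega) (((complex M).d p (p + 1)).hom x) y +
        ((-1 : A) ^ p) • cup μ p (q + 1) (n + 1) (by omega) x (((complex N).d q (q + 1)).hom y) := by
  classical
  have h₁ : p + 1 + q = n + 1 := by omega
  have h₂ : p + (q + 1) = n + 1 := by omega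
  funext γ
  set t := Finset.univ.image γ with ht
  -- the generic term
  let T : (Fin (p + 1) → ι) → (Fin (q + 1) → ι) → P.obj t := fun F B =>
    if hF : Finset.univ.image F ⊆ t then
      if hB : Finset.univ.image B ⊆ t then μ t ((M.map (homOfLE hF)).hom (x F)) ((N.map (homOfLE hB)).hom (y B)) else 0
    else 0
  have hT : ∀ (F : Fin (p + 1) → ι) (B : Fin (q + 1) → ι) (hF : Finset.univ.image F ⊆ t) (hB : Finset.univ.image B ⊆ t),
      T F B = μ t ((M.map (homOfLE hF)).hom (x F)) ((N.map (homOfLE hB)).hom (y B)) := fun F B hF hB => by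
    simp only [T, dif_pos hF, dif_pos hB]
  -- LHS = Σ_j (-1)^j T(front (γ∘δ_j), back (γ∘δ_j))
  have hL : ((complex P).d n (n + 1)).hom (cup μ p q n h x y) γ =
      ∑ j : Fin (n + 2), (-1 : A) ^ (j : ℕ) • T (front p q n h (γ ∘ j.succAbove)) (back p q n h (γ ∘ j.succAbove)) := by
    rw [complex_d_apply]
    refine Finset.sum_congr rfl fun j _ => ?_
    rw [neg_one_pow_zsmul (A := A), cup_apply, hμ, map_map_apply, map_map_apply,
      hT _ _ ((image_front_subset _ _ _ _ _).trans (image_comp_subset γ _))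
        ((image_back_subset _ _ _ _ _).trans (image_comp_subset γ _))]
  -- first RHS term = Σ_{i : Fin (p+2)} (-1)^i T(front_{p+1} γ ∘ δ_i, back_q γ)
  have hR₁ : cup μ (p + 1) q (n + 1) h₁ (((complex M).d p (p + 1)).hom x) y γ =
      ∑ i : Fin (p + 2), (-1 : A) ^ (i : ℕ) •
        T (front (p + 1) q (n + 1) h₁ γ ∘ i.succAbove) (back (p + 1) q (n + 1) h₁ γ) := by
    rw [cup_apply, complex_d_apply, map_sum, map_sum, LinearMap.sum_apply]
    refine Finset.sum_congr rfl fun i _ => ?_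
    rw [map_zsmul, map_zsmul, LinearMap.smul_apply, neg_one_pow_zsmul (A := A), map_map_apply,
      hT _ _ ((image_comp_subset _ _).trans (image_front_subset _ _ _ _ γ)) (image_back_subset _ _ _ _ γ)]
  -- second RHS term = Σ_{i : Fin (q+2)} (-1)^i T(front_p γ, back_{q+1} γ ∘ δ_i)
  have hR₂ : cup μ p (q + 1) (n + 1) h₂ x (((complex N).d q (q + 1)).hom y) γ =
      ∑ i : Fin (q + 2), (-1 : A) ^ (i : ℕ) •
        T (front p (q + 1) (n + 1) h₂ γ) (back p (q + 1) (n + 1) h₂ γ ∘ i.succAbove) := by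
    rw [cup_apply, complex_d_apply, map_sum, map_sum]
    refine Finset.sum_congr rfl fun i _ => ?_
    rw [map_zsmul, map_zsmul, neg_one_pow_zsmul (A := A), map_map_apply,
      hT _ _ (image_front_subset _ _ _ _ γ) ((image_comp_subset _ _).trans (image_back_subset _ _ _ _ γ))]
  change _ = cup μ (p + 1) q (n + 1) h₁ _ y γ + ((-1 : A) ^ p) • cup μ p (q + 1) (n + 1) h₂ x _ γ
  rw [hL, hR₁, hR₂]
  -- split the LHS sum at position `p + 1`
  have e : p + 1 + (q + 1) = n + 2 := by omega
  rw [← Fintype.sum_equiv (finCongr e) (fun k => (-1 : A) ^ ((Fin.cast e k : Fin (n + 2)) : ℕ) •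
      T (front p q n h (γ ∘ (Fin.cast e k).succAbove)) (back p q n h (γ ∘ (Fin.cast e k).succAbove))) _ (fun k => rfl),
    Fin.sum_univ_add]
  -- front block
  have hA : ∀ a : Fin (p + 1),
      (-1 : A) ^ ((Fin.cast e (Fin.castAdd (q + 1) a) : Fin (n + 2)) : ℕ) •
        T (front p q n h (γ ∘ (Fin.cast e (Fin.castAdd (q + 1) a)).succAbove))
          (back p q n h (γ ∘ (Fin.cast e (Fin.castAdd (q + 1) a)).succAbove)) =
      (-1 : A) ^ ((Fin.castSucc a : Fin (p + 2)) : ℕ) •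
        T (front (p + 1) q (n + 1) h₁ γ ∘ (Fin.castSucc a).succAbove) (back (p + 1) q (n + 1) h₁ γ) := by
    intro a
    obtain ⟨hf, hb⟩ := front_back_comp_succAbove_of_le h h₁ γ (Fin.cast e (Fin.castAdd (q + 1) a))
      (by simp only [Fin.val_cast, Fin.val_castAdd]; omega)
    have hidx : (⟨((Fin.cast e (Fin.castAdd (q + 1) a) : Fin (n + 2)) : ℕ), by
        simp only [Fin.val_cast, Fin.val_castAdd]; omega⟩ : Fin (p + 2)) = Fin.castSucc a :=
      Fin.ext (by simp only [Fin.val_cast, Fin.val_castAdd, Fin.val_castSucc])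
    rw [hidx] at hf
    rw [hf, hb]
    simp only [Fin.val_cast, Fin.val_castAdd, Fin.val_castSucc]
  -- back block
  have hB : ∀ b : Fin (q + 1),
      (-1 : A) ^ ((Fin.cast e (Fin.natAdd (p + 1) b) : Fin (n + 2)) : ℕ) •
        T (front p q n h (γ ∘ (Fin.cast e (Fin.natAdd (p + 1) b)).succAbove))
          (back p q n h (γ ∘ (Fin.cast e (Fin.natAdd (p + 1) b)).succAbove)) =
      (-1 : A) ^ p • ((-1 : A) ^ ((b.succ : Fin (q + 2)) : ℕ) •
        T (front p (q + 1) (n + 1) h₂ γ) (back p (q + 1) (n + 1) h₂ γ ∘ b.succ.succAbove)) := by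
    intro b
    obtain ⟨hf, hb⟩ := front_back_comp_succAbove_of_gt h h₂ γ (Fin.cast e (Fin.natAdd (p + 1) b)) b
      (by simp only [Fin.val_cast, Fin.val_natAdd])
    rw [hf, hb, smul_smul, ← pow_add]
    congr 1
    simp only [Fin.val_cast, Fin.val_natAdd, Fin.val_succ]
    congr 1
    omega
  rw [Finset.sum_congr rfl fun a _ => hA a, Finset.sum_congr rfl fun b _ => hB b, ← Finset.smul_sum]
  -- split off the two middle terms on the right
  have hR₁' := Fin.sum_univ_castSucc fun i : Fin (p + 2) =>
    (-1 : A) ^ (i : ℕ) • T (front (p + 1) q (n + 1) h₁ γ ∘ i.succAbove) (back (p + 1) q (n + 1) h₁ γ)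
  have hR₂' := Fin.sum_univ_succ fun i : Fin (q + 2) =>
    (-1 : A) ^ (i : ℕ) • T (front p (q + 1) (n + 1) h₂ γ) (back p (q + 1) (n + 1) h₂ γ ∘ i.succAbove)
  rw [hR₁', hR₂']
  -- the two middle terms cancel
  obtain ⟨hm₁, hm₂⟩ := front_last_back_zero h₁ h₂ γ
  rw [hm₁, hm₂, Fin.val_last, Fin.val_zero, pow_zero, one_smul, pow_succ, smul_add,
    show ((-1 : A) ^ p * -1) = -((-1 : A) ^ p) by ring, neg_smul]
  abel

end Leibniz

/-! ## §3 Pull-backs along arbitrary index maps are multiplicative on cochains -/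

section PullbackCup

variable {M} {N P : Finset ι ⥤ ModuleCat.{v} A} (μ : ∀ s : Finset ι, M.obj s →ₗ[A] N.obj s →ₗ[A] P.obj s)
  {ι' : Type} [LinearOrder ι'] {M' N' P' : Finset ι' ⥤ ModuleCat.{v} A}
  (μ' : ∀ s' : Finset ι', M'.obj s' →ₗ[A] N'.obj s' →ₗ[A] P'.obj s')
  (θ : ι' → ι) (φM : imageFunctor θ ⋙ M ⟶ M') (φN : imageFunctor θ ⋙ N ⟶ N') (φP : imageFunctor θ ⋙ P ⟶ P')

omit [LinearOrder ι] [LinearOrder ι'] in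
/-- The front face of a reindexed tuple is the reindexed front face (definitional). [cite: StacksProject, Tag 01FP] -/
theorem front_comp {p q n : ℕ} (h : p + q = n) (α' : Fin (n + 1) → ι') :
    front p q n h (θ ∘ α') = θ ∘ front p q n h α' := rfl

omit [LinearOrder ι] [LinearOrder ι'] in
/-- The back face of a reindexed tuple is the reindexed back face (definitional). [cite: StacksProject, Tag 01FP] -/
theorem back_comp {p q n : ℕ} (h : p + q = n) (α' : Fin (n + 1) → ι') :
    back p q n h (θ ∘ α') = θ ∘ back p q n h α' := rfl

omit [LinearOrder ι'] in
/-- Naturality of `φ` in the form used below: `φ_{t'}(a|) = (φ_{s'} a)|` for `s' ⊆ t'`. [folklore] -/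
private theorem phi_map {Q : Finset ι ⥤ ModuleCat.{v} A} {Q' : Finset ι' ⥤ ModuleCat.{v} A}
    (φ : imageFunctor θ ⋙ Q ⟶ Q') {s' t' : Finset ι'} (hst : s' ⊆ t') (a : Q.obj (s'.image θ)) :
    (φ.app t').hom ((Q.map (homOfLE (Finset.image_subset_image hst))).hom a) =
      (Q'.map (homOfLE hst)).hom ((φ.app s').hom a) := by
  have hnat := φ.naturality (homOfLE hst)
  have h1 : (Q'.map (homOfLE hst)).hom ((φ.app s').hom a) = (φ.app s' ≫ Q'.map (homOfLE hst)).hom a := rfl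
  rw [h1, ← hnat]
  rfl

/-- **Pull-back along an arbitrary map of index sets is MULTIPLICATIVE ON COCHAINS for the position cup product**:
`Θ(x ∪_μ y) = Θx ∪_{μ'} Θy`, for pairings `μ`, `μ'` intertwined by the restriction data (`φ_P(μ(a,b)) = μ'(φ_M a, φ_N b)`)
and `μ` natural.  (Alexander–Whitney is natural under simplicial maps; no order on the index sets enters.)
[cite: StacksProject, Tag 01FP] -/
theorem pullbackCochain_cup
    (hμ : ∀ ⦃s t : Finset ι⦄ (hst : s ⊆ t) (a : M.obj s) (b : N.obj s),
      (P.map (homOfLE hst)).hom (μ s a b) = μ t ((M.map (homOfLE hst)).hom a) ((N.map (homOfLE hst)).hom b))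
    (hφ : ∀ (s' : Finset ι') (a : M.obj (s'.image θ)) (b : N.obj (s'.image θ)),
      (φP.app s').hom (μ (s'.image θ) a b) = μ' s' ((φM.app s').hom a) ((φN.app s').hom b))
    {p q n : ℕ} (h : p + q = n) (x : Cochain M p) (y : Cochain N q) :
    pullbackCochain θ φP n (cup μ p q n h x y) =
      cup μ' p q n h (pullbackCochain θ φM p x) (pullbackCochain θ φN q y) := by
  funext α'
  rw [pullbackCochain_apply, cup_apply, cup_apply, pullbackCochain_apply, pullbackCochain_apply, hμ,
    map_map_apply, map_map_apply, ← phi_map θ φM, ← phi_map θ φN]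
  dsimp only [imageFunctor_obj, Functor.comp_obj]
  rw [map_map_apply, map_map_apply, ← hφ]
  rfl

end PullbackCup

end Full

end OrderedCech

end Literature.Algebra.Homology

end
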